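import Summits.HodgeConjecture.HodgeConjecture.Theorems.Ring2WeilCoverageCMFieldRationalClassesDFourDyadic
import HarnessLib

/-!
# Ring 2 — Weil-family coverage, CM-field rows: THE RATIONAL SUPPORT OF THE NON-GALOIS TABLE `E = ℚ(√-(3+√2))` — which places
  of `F = ℚ(√2)` occur in a rational row `T(c)`, `c ∈ ℚ_{>0}`, and the both-or-none constraint (WEIL-FAMILY-COVERAGE «## b03», cell (xvi′)
  necessity, part 57)

research route conditional on HC_CM; not a corollary; Q11.4-sentence-2 already refuted in dim ≥ 3.

Carrier `R = S² + 6S + 7` (`θ = -3 ± √2`, `θθ' = 7`; rows `T(t) = {𝔭 : (t, θ)_𝔭 = -1}`) [cite: Deligne1982HodgeCycles, §4 (1), Cor. 4.2].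
With part 55 (`v₂ = (√2)`), part 54 (`𝔭_θ`, `𝔭'`, odd `v ∌ θ`) every place has its rational rows; this file records the CONSTRAINTS that cut
the rational rows out of the even finite sets of places:

* §164 **every place of a rational row `T(c)` is `v₂`, `𝔭_θ`, or an odd `u ∌ θ` over a prime `ℓ` with `u ∈ T(ℓ)` and `ord_ℓ(c)` odd**
  (no infinite place, `𝔭'` never); at an INERT `ℓ ≡ ±3 (8)`: `(ℓ) ∈ T(c) ⟺ ord_ℓ(c)` odd `∧ ([(ℓ|7) = -1] XOR [ℓ ≡ 3 (4)])` — so `(ℓ)` lies in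
  NO rational row when `ℓ` is of split type (`ℓ ≡ 5 (8)`, `(ℓ|7) = 1`) or of three type (`ℓ ≡ 3 (8)`, `(ℓ|7) = -1`);
* §165 at a SPLIT `ℓ ≠ 7`: if `(7|ℓ) = 1` the two places over `ℓ` are TOGETHER in or out of every rational row (**both-or-none persists**);
  if `(7|ℓ) = -1` (lonely) the good place `v₀` lies in NO rational row and the bad one `v₁ ∈ T(c) ⟺ ord_ℓ(c)` odd;
* §166 **two DISTINCT primes lie on the same row only on the split row `∅` or on the row `{v₂, 𝔭_θ}` of `3` and `7`** (a row through
  a place over `ℓ` contains no other prime).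
No new definition, no named fact, no sorry; nothing about the Hodge conjecture is asserted.
-/

noncomputable section

set_option linter.dupNamespace false

open Polynomial NumberField IsDedekindDomain

namespace Summit.HodgeConjecture.HodgeConjecture.Ring2.WeilCoverageCM

open Literature.AlgebraicGeometry.Deligne1982
open Literature.AlgebraicGeometry.HodgeTheory (splitDiscriminantClassCM)
open Literature.NumberTheory.QuadraticForms

variable {R : Polynomial ℤ} [Fact (Irreducible (cmPolyQ R))] [Fact (Irreducible (realPolyQ R))]

section DFourSupport

/-! ### §164 The rational support: which places occur in some `T(c)`, `c ∈ ℚ_{>0}` -/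

/-- **`ℚ(√-(3+√2))` — THE SHAPE OF A RATIONAL ROW**: for `c ∈ ℚ_{>0}` every place of `T(c)` is the dyadic `v₂`, or `𝔭_θ`, or a finite odd
place `u ∌ θ` over a prime `ℓ` with `u ∈ T(ℓ)` and `ord_ℓ(c)` odd (no infinite place: `c > 0`; `𝔭' ∋ θ - 1` never; prime support, part 41).
[cite: Deligne1982HodgeCycles, §4 (1)] [cite: Omeara1963, §63B Example 63:12] -/
theorem dFour_mem_badPlaces_ratCast_cases (hR : R = X ^ 2 + C 6 * X + C 7) {θₒ : 𝓞 (realField R)}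
    (hθ : (θₒ : realField R) = AdjoinRoot.root (realPolyQ R)) (v₂ : HeightOneSpectrum (𝓞 (realField R)))
    (h2 : (2 : 𝓞 (realField R)) ∈ v₂.asIdeal) (w : HeightOneSpectrum (𝓞 (realField R)))
    (h7w : ((7 : ℕ) : 𝓞 (realField R)) ∈ w.asIdeal) (hθw : θₒ ∈ w.asIdeal) {c : ℚ} (hc : 0 < c)
    {x : HeightOneSpectrum (𝓞 (realField R)) ⊕ InfinitePlace (realField R)}
    (hx : x ∈ badPlaces (c : realField R) (AdjoinRoot.root (realPolyQ R))) :
    x = Sum.inl v₂ ∨ x = Sum.inl w ∨ ∃ (u : HeightOneSpectrum (𝓞 (realField R))) (ℓ : ℕ), x = Sum.inl u ∧ ℓ.Prime ∧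
      (2 : 𝓞 (realField R)) ∉ u.asIdeal ∧ θₒ ∉ u.asIdeal ∧ (ℓ : 𝓞 (realField R)) ∈ u.asIdeal ∧ Odd (padicValRat ℓ c) ∧
      Sum.inl u ∈ badPlaces (ℓ : realField R) (AdjoinRoot.root (realPolyQ R)) := by
  have hK := finrank_realField_quadratic hR
  have hsev : (7 : ℕ).Prime := by norm_num
  have hroots := roots_real_neg_of_quadratic hR (by norm_num) (by norm_num) (by norm_num)
  have hπ : (θₒ + 3) ^ 2 = 2 * 1 := by rw [dFour_sq_eq_two hR hθ, mul_one]
  rcases x with u | u'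
  · by_cases h2u : (2 : 𝓞 (realField R)) ∈ u.asIdeal
    · exact Or.inl (by rw [dyadic_unique_of_sq_eq_two_mul_unit hK isUnit_one hπ u v₂ h2u h2])
    by_cases hθu : θₒ ∈ u.asIdeal
    · -- `7 ∈ u`: `u = 𝔭_θ` (bad) or `u = 𝔭'` (never in a rational row)
      obtain ⟨w₁, w', -, h7w₁, h7w', hθw₁, h1w', -, -, -, -, hall⟩ := dFour_places_over_seven hR hθ
      have h7u : ((7 : ℤ) : 𝓞 (realField R)) ∈ u.asIdeal := intCast_mem_of_root_mem hR hθ u hθu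
      have hw₁ : w = w₁ := by
        rcases hall w h7w with h | h
        · exact h
        · exfalso
          rw [h] at hθw
          exact w'.isPrime.ne_top ((Ideal.eq_top_iff_one _).2 (by
            have e : (1 : 𝓞 (realField R)) = θₒ - (θₒ - 1) := by ring
            rw [e]; exact w'.asIdeal.sub_mem hθw h1w'))
      rcases hall u (by exact_mod_cast h7u) with h | h
      · exact Or.inr (Or.inl (by rw [h, hw₁]))
      · exfalso
        rw [h] at hx
        exact dFour_inl_notMem_badPlaces_ratCast_of_root_sub_one_mem hθ w' h7w' h1w' hc hx
    · obtain ⟨ℓ, hℓ, hℓu⟩ := exists_prime_natCast_mem u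
      have key := (dFour_inl_mem_badPlaces_ratCast_iff_of_root_notMem hθ u h2u hθu hℓ hℓu hc).1 hx
      exact Or.inr (Or.inr ⟨u, ℓ, rfl, hℓ, h2u, hθu, hℓu, key.1, key.2⟩)
  · exact absurd hx (inr_notMem_badPlaces_ratCast_of_pos hroots u' hc)

/-- **`ℚ(√-(3+√2))`, INERT `ℓ ≡ ±3 (mod 8)`, `u ∋ ℓ`: `u ∈ T(c) ⟺ ord_ℓ(c)` odd `∧ ([(ℓ|7) = -1] XOR [ℓ ≡ 3 (mod 4)])`** (`c ∈ ℚ_{>0}`;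
prime support and part 54's `(7|ℓ) = -1` read through `(7|ℓ)(ℓ|7) = (-1)^{(ℓ-1)/2}`). In particular `(ℓ)` lies in NO rational row when `ℓ` is
of split type (`ℓ ≡ 5 (8)`, `ℓ ≡ 1, 2, 4 (7)`) or of three type (`ℓ ≡ 3 (8)`, `ℓ ≡ 3, 5, 6 (7)`).
[cite: Deligne1982HodgeCycles, §4 (1)] [cite: Omeara1963, §63B Example 63:12] -/
theorem dFour_inl_mem_badPlaces_ratCast_iff_of_inert (hR : R = X ^ 2 + C 6 * X + C 7) {ℓ : ℕ} (hℓ : ℓ.Prime)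
    (hin : ℓ % 8 = 3 ∨ ℓ % 8 = 5) (u : HeightOneSpectrum (𝓞 (realField R))) (hℓu : (ℓ : 𝓞 (realField R)) ∈ u.asIdeal)
    {c : ℚ} (hc : 0 < c) :
    Sum.inl u ∈ badPlaces (c : realField R) (AdjoinRoot.root (realPolyQ R)) ↔
      Odd (padicValRat ℓ c) ∧ Xor (ℓ % 7 = 3 ∨ ℓ % 7 = 5 ∨ ℓ % 7 = 6) (ℓ % 4 = 3) := by
  have hℓ2 : ℓ ≠ 2 := by rintro rfl; omega
  have hℓ7 : ℓ ≠ 7 := by rintro rfl; omega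
  have key := xor_nonsquare_mod_seven_not_isSquare_seven_iff hℓ hℓ2 hℓ7
  obtain ⟨hRm, -⟩ := monic_and_natDegree_of_quadratic R hR
  obtain ⟨θₒ, hθ⟩ := exists_ringOfIntegers_coe_eq_root hRm
  have h2u := two_notMem_of_natCast_mem hℓ hℓ2 u hℓu
  have hℓq : ¬ (ℓ : ℤ) ∣ 7 := fun h ↦ hℓ7 ((Nat.prime_dvd_prime_iff_eq hℓ (by norm_num : (7 : ℕ).Prime)).1 (by exact_mod_cast h))
  have hθu := root_notMem_of_not_dvd hR hθ hℓ hℓq u hℓu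
  rw [dFour_inl_mem_badPlaces_ratCast_iff_of_root_notMem hθ u h2u hθu hℓ hℓu hc,
    dFour_inl_mem_badPlaces_natCast_iff_of_inert hR hθ hℓ hin u hℓu]
  -- `¬ IsSquare 7 ⟺ Xor A B` from `Xor A (¬ IsSquare 7) ⟺ B`
  refine and_congr_right fun _ ↦ ⟨fun hnS ↦ ?_, fun hx hS ↦ ?_⟩
  · by_cases hA : ℓ % 7 = 3 ∨ ℓ % 7 = 5 ∨ ℓ % 7 = 6
    · exact Or.inl ⟨hA, fun hB ↦ (key.2 hB).elim (fun h ↦ h.2 hnS) fun h ↦ h.2 hA⟩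
    · exact Or.inr ⟨key.1 (Or.inr ⟨hnS, hA⟩), hA⟩
  · rcases hx with ⟨hA, hnB⟩ | ⟨hB, hnA⟩
    · exact hnB (key.1 (Or.inl ⟨hA, fun hn ↦ hn hS⟩))
    · exact (key.2 hB).elim (fun h ↦ hnA h.1) fun h ↦ h.1 hS

/-- **Split-type and three-type inert primes carry no rational row through `(ℓ)`**: `ℓ ≡ 5 (8)` with `ℓ ≡ 1, 2, 4 (7)`, or `ℓ ≡ 3 (8)` with
`ℓ ≡ 3, 5, 6 (7)` ⟹ `(ℓ) ∉ T(c)` for every `c ∈ ℚ_{>0}`. [cite: Deligne1982HodgeCycles, §4 (1)] [cite: Omeara1963, §63B Example 63:12] -/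
theorem dFour_inl_notMem_badPlaces_ratCast_of_inert (hR : R = X ^ 2 + C 6 * X + C 7) {ℓ : ℕ} (hℓ : ℓ.Prime)
    (h : (ℓ % 8 = 5 ∧ (ℓ % 7 = 1 ∨ ℓ % 7 = 2 ∨ ℓ % 7 = 4)) ∨ (ℓ % 8 = 3 ∧ (ℓ % 7 = 3 ∨ ℓ % 7 = 5 ∨ ℓ % 7 = 6)))
    (u : HeightOneSpectrum (𝓞 (realField R))) (hℓu : (ℓ : 𝓞 (realField R)) ∈ u.asIdeal) {c : ℚ} (hc : 0 < c) :
    Sum.inl u ∉ badPlaces (c : realField R) (AdjoinRoot.root (realPolyQ R)) := by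
  have hin : ℓ % 8 = 3 ∨ ℓ % 8 = 5 := by omega
  have hnx : ¬ Xor (ℓ % 7 = 3 ∨ ℓ % 7 = 5 ∨ ℓ % 7 = 6) (ℓ % 4 = 3) := by unfold Xor; omega
  rw [dFour_inl_mem_badPlaces_ratCast_iff_of_inert hR hℓ hin u hℓu hc]
  exact fun hx ↦ hnx hx.2

/-! ### §165 Split primes: both-or-none persists; the good place of a lonely prime lies in no rational row -/

/-- **BOTH-OR-NONE PERSISTS**: for a split `ℓ ≡ ±1 (mod 8)`, `ℓ ≠ 7`, with `(7|ℓ) = 1` (`(ℓ % 8, ℓ % 7) ∈ {1} × {1,2,4} ∪ {7} × {3,5,6}`),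
the two places `v ≠ v'` over `ℓ` satisfy `v ∈ T(c) ⟺ v' ∈ T(c)` for EVERY `c ∈ ℚ_{>0}`. [cite: Deligne1982HodgeCycles, §4 (1)]
[cite: Omeara1963, §63B Cor. 63:11a and Example 63:12] -/
theorem dFour_fibre_iff_ratCast (hR : R = X ^ 2 + C 6 * X + C 7) {θₒ : 𝓞 (realField R)}
    (hθ : (θₒ : realField R) = AdjoinRoot.root (realPolyQ R)) {ℓ : ℕ} (hℓ : ℓ.Prime)
    (h : (ℓ % 8 = 1 ∧ (ℓ % 7 = 1 ∨ ℓ % 7 = 2 ∨ ℓ % 7 = 4)) ∨ (ℓ % 8 = 7 ∧ (ℓ % 7 = 3 ∨ ℓ % 7 = 5 ∨ ℓ % 7 = 6))) :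
    ∃ v v' : HeightOneSpectrum (𝓞 (realField R)), v ≠ v' ∧ (ℓ : 𝓞 (realField R)) ∈ v.asIdeal ∧
      (ℓ : 𝓞 (realField R)) ∈ v'.asIdeal ∧
      (∀ u : HeightOneSpectrum (𝓞 (realField R)), (ℓ : 𝓞 (realField R)) ∈ u.asIdeal → u = v ∨ u = v') ∧
      ∀ c : ℚ, 0 < c → (Sum.inl v ∈ badPlaces (c : realField R) (AdjoinRoot.root (realPolyQ R)) ↔
        Sum.inl v' ∈ badPlaces (c : realField R) (AdjoinRoot.root (realPolyQ R))) := by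
  have hℓ2 : ℓ ≠ 2 := by rintro rfl; omega
  have hℓ7 : ℓ ≠ 7 := by rintro rfl; omega
  have hsp : ℓ % 8 = 1 ∨ ℓ % 8 = 7 := by omega
  have hy7 : IsSquare (7 : ZMod ℓ) := by rw [isSquare_seven_iff hℓ hℓ2 hℓ7]; omega
  have hℓq : ¬ (ℓ : ℤ) ∣ 7 := fun h' ↦ hℓ7 ((Nat.prime_dvd_prime_iff_eq hℓ (by norm_num : (7 : ℕ).Prime)).1 (by exact_mod_cast h'))
  obtain ⟨v, v', hvv', hℓv, hℓv', hall, hfib⟩ := dFour_fibre_iff_isSquare_seven hR hθ hℓ hsp hℓ7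
  refine ⟨v, v', hvv', hℓv, hℓv', hall, fun c hc ↦ ?_⟩
  rw [dFour_inl_mem_badPlaces_ratCast_iff_of_root_notMem hθ v (two_notMem_of_natCast_mem hℓ hℓ2 v hℓv)
      (root_notMem_of_not_dvd hR hθ hℓ hℓq v hℓv) hℓ hℓv hc,
    dFour_inl_mem_badPlaces_ratCast_iff_of_root_notMem hθ v' (two_notMem_of_natCast_mem hℓ hℓ2 v' hℓv')
      (root_notMem_of_not_dvd hR hθ hℓ hℓq v' hℓv') hℓ hℓv' hc, hfib.2 hy7]

/-- **LONELY PRIMES IN THE RATIONAL ROWS**: for a split `ℓ ≠ 7` with `(7|ℓ) = -1` (`(ℓ % 8, ℓ % 7) ∈ {1} × {3,5,6} ∪ {7} × {1,2,4}`) the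
places over `ℓ` are a bad `v₁` and a good `v₀`: **`v₁ ∈ T(c) ⟺ ord_ℓ(c)` odd, and `v₀` lies in NO rational row** (`c ∈ ℚ_{>0}`).
[cite: Deligne1982HodgeCycles, §4 (1)] [cite: Omeara1963, §63B Cor. 63:11a and Example 63:12] -/
theorem dFour_lonely_ratCast (hR : R = X ^ 2 + C 6 * X + C 7) {θₒ : 𝓞 (realField R)}
    (hθ : (θₒ : realField R) = AdjoinRoot.root (realPolyQ R)) {ℓ : ℕ} (hℓ : ℓ.Prime)
    (h : (ℓ % 8 = 1 ∧ (ℓ % 7 = 3 ∨ ℓ % 7 = 5 ∨ ℓ % 7 = 6)) ∨ (ℓ % 8 = 7 ∧ (ℓ % 7 = 1 ∨ ℓ % 7 = 2 ∨ ℓ % 7 = 4))) :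
    ∃ v₁ v₀ : HeightOneSpectrum (𝓞 (realField R)), v₁ ≠ v₀ ∧ (ℓ : 𝓞 (realField R)) ∈ v₁.asIdeal ∧
      (ℓ : 𝓞 (realField R)) ∈ v₀.asIdeal ∧
      (∀ u : HeightOneSpectrum (𝓞 (realField R)), (ℓ : 𝓞 (realField R)) ∈ u.asIdeal → u = v₁ ∨ u = v₀) ∧
      ∀ c : ℚ, 0 < c → (Sum.inl v₁ ∈ badPlaces (c : realField R) (AdjoinRoot.root (realPolyQ R)) ↔ Odd (padicValRat ℓ c)) ∧
        Sum.inl v₀ ∉ badPlaces (c : realField R) (AdjoinRoot.root (realPolyQ R)) := by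
  have hℓ2 : ℓ ≠ 2 := by rintro rfl; omega
  have hℓ7 : ℓ ≠ 7 := by rintro rfl; omega
  have hsp : ℓ % 8 = 1 ∨ ℓ % 8 = 7 := by omega
  have hn7 : ¬ IsSquare (7 : ZMod ℓ) := by rw [isSquare_seven_iff hℓ hℓ2 hℓ7]; omega
  have hℓq : ¬ (ℓ : ℤ) ∣ 7 := fun h' ↦ hℓ7 ((Nat.prime_dvd_prime_iff_eq hℓ (by norm_num : (7 : ℕ).Prime)).1 (by exact_mod_cast h'))
  obtain ⟨v, v', hvv', hℓv, hℓv', hall, hfib⟩ := dFour_fibre_iff_isSquare_seven hR hθ hℓ hsp hℓ7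
  have hrat : ∀ u : HeightOneSpectrum (𝓞 (realField R)), (ℓ : 𝓞 (realField R)) ∈ u.asIdeal → ∀ c : ℚ, 0 < c →
      (Sum.inl u ∈ badPlaces (c : realField R) (AdjoinRoot.root (realPolyQ R)) ↔
        Odd (padicValRat ℓ c) ∧ Sum.inl u ∈ badPlaces (ℓ : realField R) (AdjoinRoot.root (realPolyQ R))) :=
    fun u hu c hc ↦ dFour_inl_mem_badPlaces_ratCast_iff_of_root_notMem hθ u (two_notMem_of_natCast_mem hℓ hℓ2 u hu)
      (root_notMem_of_not_dvd hR hθ hℓ hℓq u hu) hℓ hu hc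
  -- exactly one of `v`, `v'` is bad
  by_cases hv : Sum.inl v ∈ badPlaces (ℓ : realField R) (AdjoinRoot.root (realPolyQ R))
  · have hv' : Sum.inl v' ∉ badPlaces (ℓ : realField R) (AdjoinRoot.root (realPolyQ R)) :=
      fun hv' ↦ hn7 (hfib.1 (iff_of_true hv hv'))
    refine ⟨v, v', hvv', hℓv, hℓv', hall, fun c hc ↦ ⟨?_, fun hx ↦ hv' ((hrat v' hℓv' c hc).1 hx).2⟩⟩
    rw [hrat v hℓv c hc]; exact ⟨fun hx ↦ hx.1, fun hx ↦ ⟨hx, hv⟩⟩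
  · have hv' : Sum.inl v' ∈ badPlaces (ℓ : realField R) (AdjoinRoot.root (realPolyQ R)) := by
      by_contra hv'; exact hn7 (hfib.1 (iff_of_false hv hv'))
    refine ⟨v', v, hvv'.symm, hℓv', hℓv, fun u hu ↦ (hall u hu).symm, fun c hc ↦ ⟨?_, fun hx ↦ hv ((hrat v hℓv c hc).1 hx).2⟩⟩
    rw [hrat v' hℓv' c hc]; exact ⟨fun hx ↦ hx.1, fun hx ↦ ⟨hx, hv'⟩⟩

/-! ### §166 Distinct primes on the same row -/

/-- **`ℚ(√-(3+√2))`: two DISTINCT primes `ℓ ≠ ℓ'` with `T(ℓ) = T(ℓ')` lie on the split row or on the row of `3` and `7`: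
`T(ℓ) = ∅ ∨ T(ℓ) = {v₂, 𝔭_θ}`** (a bad place `u ∌ θ` of `T(ℓ)` is odd and contains `ℓ` — and `ℓ'`, impossible; so
`T(ℓ) ⊆ {v₂, 𝔭_θ}`, of even size by Hilbert reciprocity 71:18). With parts V∕W: the first case is «both of split type», the second
«both of three type» (`T(3) = {v₂, 𝔭_θ}`). [cite: Omeara1963, §63B Example 63:12 and §71D Thm. 71:18] [cite: Deligne1982HodgeCycles, §4 (1)] -/
theorem dFour_badPlaces_natCast_eq_of_ne (hR : R = X ^ 2 + C 6 * X + C 7) {θₒ : 𝓞 (realField R)}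
    (hθ : (θₒ : realField R) = AdjoinRoot.root (realPolyQ R)) (v₂ : HeightOneSpectrum (𝓞 (realField R)))
    (h2 : (2 : 𝓞 (realField R)) ∈ v₂.asIdeal) (w : HeightOneSpectrum (𝓞 (realField R)))
    (h7w : ((7 : ℕ) : 𝓞 (realField R)) ∈ w.asIdeal) (hθw : θₒ ∈ w.asIdeal) {ℓ ℓ' : ℕ} (hℓ : ℓ.Prime) (hℓ' : ℓ'.Prime)
    (hne : ℓ ≠ ℓ') (heq : badPlaces (ℓ : realField R) (AdjoinRoot.root (realPolyQ R)) =
      badPlaces (ℓ' : realField R) (AdjoinRoot.root (realPolyQ R))) :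
    badPlaces (ℓ : realField R) (AdjoinRoot.root (realPolyQ R)) = ∅ ∨
      badPlaces (ℓ : realField R) (AdjoinRoot.root (realPolyQ R)) = {Sum.inl v₂, Sum.inl w} := by
  have hℓ0 : (ℓ : realField R) ≠ 0 := by exact_mod_cast hℓ.ne_zero
  have h2w : (2 : 𝓞 (realField R)) ∉ w.asIdeal := two_notMem_of_natCast_mem (by norm_num : (7 : ℕ).Prime) (by norm_num) w h7w
  have hwv₂ : (Sum.inl v₂ : HeightOneSpectrum (𝓞 (realField R)) ⊕ InfinitePlace (realField R)) ≠ Sum.inl w :=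
    fun h ↦ h2w (by rw [← Sum.inl_injective h]; exact h2)
  -- every bad place is `v₂` or `𝔭_θ`
  have hsub : badPlaces (ℓ : realField R) (AdjoinRoot.root (realPolyQ R)) ⊆ {Sum.inl v₂, Sum.inl w} := by
    intro x hx
    by_cases hxv : x = Sum.inl v₂
    · rw [hxv]; exact Set.mem_insert _ _
    obtain ⟨u, rfl, h2u, huT, hu⟩ := dFour_exists_of_mem_badPlaces_natCast_diff_dyadic hR hθ v₂ h2 w h7w hθw hℓ ⟨hx, hxv⟩
    rcases hu with huw | ⟨hθu, hℓu⟩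
    · rw [huw]; exact Set.mem_insert_of_mem _ (Set.mem_singleton _)
    · exfalso
      rw [heq] at huT
      exact hne (prime_natCast_mem_unique hℓ hℓ' u hℓu (dFour_natCast_mem_of_inl_mem_badPlaces hθ u h2u hθu hℓ' huT))
  have heven := (even_ncard_badPlaces (R := R) (Units.mk0 (ℓ : realField R) hℓ0)).2
  rw [Units.val_mk0] at heven
  by_cases hv : Sum.inl v₂ ∈ badPlaces (ℓ : realField R) (AdjoinRoot.root (realPolyQ R)) <;>
    by_cases hw : Sum.inl w ∈ badPlaces (ℓ : realField R) (AdjoinRoot.root (realPolyQ R))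
  · right
    exact hsub.antisymm (by rintro x (rfl | rfl) <;> assumption)
  · exfalso
    have hS : badPlaces (ℓ : realField R) (AdjoinRoot.root (realPolyQ R)) = {Sum.inl v₂} := by
      refine Set.Subset.antisymm (fun x hx ↦ ?_) ?_
      · rcases hsub hx with h | h
        · exact h
        · rw [Set.mem_singleton_iff] at h; rw [h] at hx; exact absurd hx hw
      · rintro x rfl; exact hv
    rw [hS, Set.ncard_singleton] at heven
    exact (Nat.not_even_iff_odd.2 odd_one) heven
  · exfalso
    have hS : badPlaces (ℓ : realField R) (AdjoinRoot.root (realPolyQ R)) = {Sum.inl w} := by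
      refine Set.Subset.antisymm (fun x hx ↦ ?_) ?_
      · rcases hsub hx with h | h
        · rw [h] at hx; exact absurd hx hv
        · exact h
      · rintro x rfl; exact hw
    rw [hS, Set.ncard_singleton] at heven
    exact (Nat.not_even_iff_odd.2 odd_one) heven
  · left
    refine Set.eq_empty_iff_forall_notMem.2 fun x hx ↦ ?_
    rcases hsub hx with h | h
    · rw [h] at hx; exact hv hx
    · rw [Set.mem_singleton_iff] at h; rw [h] at hx; exact hw hx

end DFourSupport

end Summit.HodgeConjecture.HodgeConjecture.Ring2.WeilCoverageCM

end
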